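import Summits.HodgeConjecture.HodgeConjecture.Theorems.F0P3cStCharTSHCDescentSemisimpleSliceK   -- ★ C₁ (F0P3a-p05): `charpoly_slice_eq`, `slice_sub_mem`, `isUltrametricDist_prod∕_matrix`, `properSpace_subtype_of_isClosed`, `isClosed_skew`
import Summits.HodgeConjecture.HodgeConjecture.Theorems.F0P3cStCharTSNewtonCore                    -- ★ FILE 2′ (F0P2-p01): `depth_chart_of_newtonData`
import Literature.MeasureTheory.Group.AddHaarTransportLIntegral                                    -- ★ (HT♭) (LH10-p01): `setLIntegral_image_lt_top_iff`, `image_vadd_eq`, `exists_nhds_setLIntegral_lt_top_iff_zero`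
import Literature.LinearAlgebra.Matrix.MinimalNilpotentSliceFinThree                               -- ★ (D) (F0P3-p02): `single_two_zero_bracket_eq`, `commute_single_two_zero_iff`
import Literature.LinearAlgebra.Matrix.UnitaryThreeMinimalNilpotentWitt                            -- ★ (E) (F0P3-p02): `single_zero_two_mem_iff`, `det_antidiagonal_three`
import Summits.HodgeConjecture.HodgeConjecture.Theorems.F0P3cStCharTSHCDSlodowySliceChartAlgebra -- (this seat) FILE C₀: `exists_bracket_single_two_zero_eq_of_shape`, `adK_apply`, `trace_slice_sub_eq_zero`
import HarnessLib

/-!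
# F0 · P3c · line LH6 «StCharTS» — ROAD «HC-D» brick D5(iii), FILE C «SLODOWY SLICE — THE DESCENDED CAYLEY CHART: TRANSFERS DOWN ∕ UP»

Cell `pub/hodgecm-mathlib`, crux H413 = `stmt-HodgeConjecture-24833` (lane `--supports`, helper); seat A-p12 (g29); ROAD «HC-D» (holder F0P2-p01 (g23)).  THEOREMS ONLY;
sorry-free; no definition ∕ instance ∕ notation ∕ named fact; axioms TRIO.  Pattern = ★ C₂ `…HCDescentSemisimpleSlice` (F0P3a-p05) for the NILPOTENT transversal pair
`Q = 𝔲₀ ∩ range (ad E₂₀)`, `C = 𝔲₀ ∩ 𝔷(E₂₀)` at `N = c·E₀₂`: the descended chart `e : Q × C ≃ 𝔲₀`, `e (Y, Z) = 2(NY − YN) + Z` (★ (D4d-F)∕(F-top), F0P3-p02) and its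
`K`-linear ambient form `eK` with NEWTON DATA for `Ψ(Y, Z) = c(Y)(N + Z)c(Y)⁻¹` (★ (iii-K), LH10-p01) are HYPOTHESES here; the data descend to `Q × C` along the
norm-preserving inclusion, ★ FILE 2′ `depth_chart_of_newtonData` gives injectivity, COSET images and the change of variables on the box `Λ_{k₀}` for `μQ ⊗ μC`, and on the
sub-boxes `(0, Z₀) + Λ_j` with an integrand factoring through `charpoly` (★ C₁ `charpoly_slice_eq`) one gets
`μQ(B_j) · ∫⁻_{B(Z₀, j)} g (N + Z) dμC = ∫⁻_{(0,Z₀)+Λ_j} g (N + e v) dμ`, finite iff `∫⁻_{Z₀ + e(Λ_j)} g (N + X) dμ₀` is (★ (HT♭)).  Hence the two TRANSFERS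
consumed by ★ FILE B `…HCDSlodowySliceAssembly` §5 — DOWN at every `Z₀` of the ball `W = B_{k₀}`, UP at `0` — from ONE chart at `N`.  HONEST LABEL: count-neutral;
closes no organ.  HC_CM is proved only modulo the 7 printed citations (2 remaining: hLiu418 = `stmt-HodgeConjecture-24832`, h413 = `stmt-HodgeConjecture-24833`) until
rung 0 closes.

## References
* [HarishChandra1970] Harish-Chandra (notes by G. van Dijk), *Harmonic analysis on reductive p-adic groups*, LNM 162 (1970), Part V §4 Lemma 22; Part VII §1 Thm. 15.
* [Slodowy1980] P. Slodowy, *Simple Singularities and Simple Algebraic Groups*, LNM 815 (1980), §7.4.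
* [Schikhof1984] W. H. Schikhof, *Ultrametric Calculus* (1984), §27 Lemma 27.4–Thm. 27.5.
-/

set_option autoImplicit false
-- the mandated namespace has the single-problem summit's repeated segment (`HodgeConjecture.HodgeConjecture`)
set_option linter.dupNamespace false

noncomputable section

open MeasureTheory Filter Metric Set Topology
open scoped Matrix Matrix.Norms.Elementwise ENNReal Pointwise
open Literature.NumberTheory.Automorphic Literature.LinearAlgebra.Matrix Literature.MeasureTheory.Group Literature.Analysis.Calculus
open Summit.HodgeConjecture.HodgeConjecture.Cruxes.H413.F0P3cStCharTSNewtonCore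
open Summit.HodgeConjecture.HodgeConjecture.Cruxes.H413.F0P3cStCharTSHCDescentSemisimpleSliceK
open Summit.HodgeConjecture.HodgeConjecture.Cruxes.H413.F0P3cStCharTSHCDSlodowySliceChartAlgebra

namespace Summit.HodgeConjecture.HodgeConjecture.Cruxes.H413.F0P3cStCharTSHCDSlodowySliceChart

/-! ## The descended chart and the transfers DOWN ∕ UP -/

section Chart

variable {K : Type*} [NontriviallyNormedField K] [IsUltrametricDist K] [CompleteSpace K] [ProperSpace K] [SecondCountableTopology K]

set_option maxHeartbeats 1600000 in
-- long subtype-product carriers; instance unification across the `Matrix`∕`Pi`∕`Submodule`∕`AddSubgroup` topologies is the cost (as ★ C₂)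
/-- **THE DESCENDED SLODOWY CHART: TRANSFERS DOWN ∕ UP.**  `K` complete ultrametric nontrivially normed, proper, second countable; `σ` continuous; `N = c·E₀₂`,
`σ c = −c`; `𝔲₀ ⊇ Q, C` as ★ (D4d-F) prints them; `e : Q × C ≃+ 𝔲₀` the descended chart, `eK` its ambient `K`-linear form with NEWTON DATA `hNK` at radii `r γʲ`, `r < 1`;
`μQ`, `μC`, `μ₀` ANY additive Haar measures; `g ≥ 0` continuous on `M₃(K)` factoring through `charpoly`.  THEN for `W` = the ball of radius `r γ^{k₀}` in `↥C`:
(DOWN) for `Z₀ ∈ W` and `X₀ = N + Z₀ ∈ 𝔲₀`, local `μ₀`-finiteness of `g` at `X₀` ⇒ local `μC`-finiteness of `Z ↦ g (N + Z)` at `Z₀`; (UP) local `μC`-finiteness at `0`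
⇒ local `μ₀`-finiteness of `g` at `N`. [cite: HarishChandra1970, Part V §4 Lemma 22; Part VII §1 Thm. 15] [cite: Slodowy1980, §7.4] [cite: Schikhof1984, §27 Lemma 27.4–Thm. 27.5] -/
theorem exists_slice_transfers
    (σ : K →+* K) (hσc : Continuous σ) {c : K} (hc : σ c = -c)
    (𝔲₀ Q C : AddSubgroup (Matrix (Fin 3) (Fin 3) K))
    (h𝔲₀ : ∀ X, X ∈ 𝔲₀ ↔ (X.map σ)ᵀ * !![(0 : K), 0, 1; 0, 1, 0; 1, 0, 0] + !![(0 : K), 0, 1; 0, 1, 0; 1, 0, 0] * X = 0 ∧ Matrix.trace X = 0)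
    (hQ : ∀ Y, Y ∈ Q ↔ Y ∈ 𝔲₀ ∧ (Y 0 1 = 0 ∧ Y 0 2 = 0 ∧ Y 1 1 = 0 ∧ Y 1 2 = 0 ∧ Y 0 0 + Y 2 2 = 0))
    (hC : ∀ Z, Z ∈ C ↔ Z ∈ 𝔲₀ ∧ Z * Matrix.single (2 : Fin 3) (0 : Fin 3) (1 : K) = Matrix.single (2 : Fin 3) (0 : Fin 3) 1 * Z)
    (e : (↥Q × ↥C) ≃+ ↥𝔲₀)
    (he : ∀ p : ↥Q × ↥C, ((e p : ↥𝔲₀) : Matrix (Fin 3) (Fin 3) K) =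
      (2 : K) • (Matrix.single (0 : Fin 3) (2 : Fin 3) c * (p.1 : Matrix (Fin 3) (Fin 3) K) - (p.1 : Matrix (Fin 3) (Fin 3) K) * Matrix.single (0 : Fin 3) (2 : Fin 3) c) +
        (p.2 : Matrix (Fin 3) (Fin 3) K))
    (eK : (↥(LinearMap.range ((LinearMap.mulLeft K (Matrix.single (2 : Fin 3) (0 : Fin 3) (1 : K)) - LinearMap.mulRight K (Matrix.single (2 : Fin 3) (0 : Fin 3) (1 : K))) : Module.End K (Matrix (Fin 3) (Fin 3) K))) × ↥(LinearMap.ker ((LinearMap.mulLeft K (Matrix.single (2 : Fin 3) (0 : Fin 3) (1 : K)) - LinearMap.mulRight K (Matrix.single (2 : Fin 3) (0 : Fin 3) (1 : K))) : Module.End K (Matrix (Fin 3) (Fin 3) K)))) ≃L[K] Matrix (Fin 3) (Fin 3) K)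
    (heK : ∀ q : (↥(LinearMap.range ((LinearMap.mulLeft K (Matrix.single (2 : Fin 3) (0 : Fin 3) (1 : K)) - LinearMap.mulRight K (Matrix.single (2 : Fin 3) (0 : Fin 3) (1 : K))) : Module.End K (Matrix (Fin 3) (Fin 3) K))) × ↥(LinearMap.ker ((LinearMap.mulLeft K (Matrix.single (2 : Fin 3) (0 : Fin 3) (1 : K)) - LinearMap.mulRight K (Matrix.single (2 : Fin 3) (0 : Fin 3) (1 : K))) : Module.End K (Matrix (Fin 3) (Fin 3) K)))), eK q =
      (2 : K) • (Matrix.single (0 : Fin 3) (2 : Fin 3) c * (q.1 : Matrix (Fin 3) (Fin 3) K) - (q.1 : Matrix (Fin 3) (Fin 3) K) * Matrix.single (0 : Fin 3) (2 : Fin 3) c) +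
        (q.2 : Matrix (Fin 3) (Fin 3) K))
    {r γ : ℝ} (hr : 0 < r) (hr1 : r < 1) (hγ0 : 0 < γ) (hγ1 : γ < 1) {k₀ : ℕ}
    (hNK : ∀ k, k₀ ≤ k → ∀ j, k ≤ j → ∀ x ∈ closedBall (0 : (↥(LinearMap.range ((LinearMap.mulLeft K (Matrix.single (2 : Fin 3) (0 : Fin 3) (1 : K)) - LinearMap.mulRight K (Matrix.single (2 : Fin 3) (0 : Fin 3) (1 : K))) : Module.End K (Matrix (Fin 3) (Fin 3) K))) × ↥(LinearMap.ker ((LinearMap.mulLeft K (Matrix.single (2 : Fin 3) (0 : Fin 3) (1 : K)) - LinearMap.mulRight K (Matrix.single (2 : Fin 3) (0 : Fin 3) (1 : K))) : Module.End K (Matrix (Fin 3) (Fin 3) K))))) (r * γ ^ k), ∀ y ∈ closedBall (0 : (↥(LinearMap.range ((LinearMap.mulLeft K (Matrix.single (2 : Fin 3) (0 : Fin 3) (1 : K)) - LinearMap.mulRight K (Matrix.single (2 : Fin 3) (0 : Fin 3) (1 : K))) : Module.End K (Matrix (Fin 3) (Fin 3) K))) × ↥(LinearMap.ker ((LinearMap.mulLeft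 K (Matrix.single (2 : Fin 3) (0 : Fin 3) (1 : K)) - LinearMap.mulRight K (Matrix.single (2 : Fin 3) (0 : Fin 3) (1 : K))) : Module.End K (Matrix (Fin 3) (Fin 3) K))))) (r * γ ^ j),
      (fun q : (↥(LinearMap.range ((LinearMap.mulLeft K (Matrix.single (2 : Fin 3) (0 : Fin 3) (1 : K)) - LinearMap.mulRight K (Matrix.single (2 : Fin 3) (0 : Fin 3) (1 : K))) : Module.End K (Matrix (Fin 3) (Fin 3) K))) × ↥(LinearMap.ker ((LinearMap.mulLeft K (Matrix.single (2 : Fin 3) (0 : Fin 3) (1 : K)) - LinearMap.mulRight K (Matrix.single (2 : Fin 3) (0 : Fin 3) (1 : K))) : Module.End K (Matrix (Fin 3) (Fin 3) K)))) => cayley (q.1 : Matrix (Fin 3) (Fin 3) K) * (Matrix.single (0 : Fin 3) (2 : Fin 3) c + (q.2 : Matrix (Fin 3) (Fin 3) K)) *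
          Ring.inverse (cayley (q.1 : Matrix (Fin 3) (Fin 3) K))) (0 + (x + y)) -
        (fun q : (↥(LinearMap.range ((LinearMap.mulLeft K (Matrix.single (2 : Fin 3) (0 : Fin 3) (1 : K)) - LinearMap.mulRight K (Matrix.single (2 : Fin 3) (0 : Fin 3) (1 : K))) : Module.End K (Matrix (Fin 3) (Fin 3) K))) × ↥(LinearMap.ker ((LinearMap.mulLeft K (Matrix.single (2 : Fin 3) (0 : Fin 3) (1 : K)) - LinearMap.mulRight K (Matrix.single (2 : Fin 3) (0 : Fin 3) (1 : K))) : Module.End K (Matrix (Fin 3) (Fin 3) K)))) => cayley (q.1 : Matrix (Fin 3) (Fin 3) K) * (Matrix.single (0 : Fin 3) (2 : Fin 3) c + (q.2 : Matrix (Fin 3) (Fin 3) K)) *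
          Ring.inverse (cayley (q.1 : Matrix (Fin 3) (Fin 3) K))) (0 + x) - eK y ∈
        (eK : (↥(LinearMap.range ((LinearMap.mulLeft K (Matrix.single (2 : Fin 3) (0 : Fin 3) (1 : K)) - LinearMap.mulRight K (Matrix.single (2 : Fin 3) (0 : Fin 3) (1 : K))) : Module.End K (Matrix (Fin 3) (Fin 3) K))) × ↥(LinearMap.ker ((LinearMap.mulLeft K (Matrix.single (2 : Fin 3) (0 : Fin 3) (1 : K)) - LinearMap.mulRight K (Matrix.single (2 : Fin 3) (0 : Fin 3) (1 : K))) : Module.End K (Matrix (Fin 3) (Fin 3) K)))) → Matrix (Fin 3) (Fin 3) K) '' closedBall 0 (r * γ ^ (j + 1)))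
    [MeasurableSpace ↥𝔲₀] [BorelSpace ↥𝔲₀] [MeasurableSpace ↥Q] [BorelSpace ↥Q] [MeasurableSpace ↥C] [BorelSpace ↥C]
    (μ₀ : Measure ↥𝔲₀) [μ₀.IsAddHaarMeasure] (μQ : Measure ↥Q) [μQ.IsAddHaarMeasure] (μC : Measure ↥C) [μC.IsAddHaarMeasure]
    (g : Matrix (Fin 3) (Fin 3) K → ℝ≥0∞) (hgc : Continuous g) (hg : ∀ X X' : Matrix (Fin 3) (Fin 3) K, X.charpoly = X'.charpoly → g X = g X') :
    ∃ W ∈ 𝓝 (0 : ↥C),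
      (∀ Z₀ ∈ W, ∀ X₀ : ↥𝔲₀, (X₀ : Matrix (Fin 3) (Fin 3) K) = Matrix.single (0 : Fin 3) (2 : Fin 3) c + (Z₀ : Matrix (Fin 3) (Fin 3) K) →
        (∃ U ∈ 𝓝 X₀, ∫⁻ X in U, g (X : Matrix (Fin 3) (Fin 3) K) ∂μ₀ < ∞) →
        ∃ U ∈ 𝓝 Z₀, ∫⁻ Z in U, g (Matrix.single (0 : Fin 3) (2 : Fin 3) c + (Z : Matrix (Fin 3) (Fin 3) K)) ∂μC < ∞) ∧
      ((∃ U ∈ 𝓝 (0 : ↥C), ∫⁻ Z in U, g (Matrix.single (0 : Fin 3) (2 : Fin 3) c + (Z : Matrix (Fin 3) (Fin 3) K)) ∂μC < ∞) →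
        ∀ X₀ : ↥𝔲₀, (X₀ : Matrix (Fin 3) (Fin 3) K) = Matrix.single (0 : Fin 3) (2 : Fin 3) c →
          ∃ U ∈ 𝓝 X₀, ∫⁻ X in U, g (X : Matrix (Fin 3) (Fin 3) K) ∂μ₀ < ∞) := by
  classical
  haveI : IsUltrametricDist (Matrix (Fin 3) (Fin 3) K) := isUltrametricDist_matrix
  haveI : SecondCountableTopology (Matrix (Fin 3) (Fin 3) K) := inferInstanceAs (SecondCountableTopology (Fin 3 → Fin 3 → K))
  haveI : ProperSpace (Matrix (Fin 3) (Fin 3) K) := inferInstanceAs (ProperSpace (Fin 3 → Fin 3 → K))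
  haveI hUQK := isUltrametricDist_submodule (LinearMap.range ((LinearMap.mulLeft K (Matrix.single (2 : Fin 3) (0 : Fin 3) (1 : K)) - LinearMap.mulRight K (Matrix.single (2 : Fin 3) (0 : Fin 3) (1 : K))) : Module.End K (Matrix (Fin 3) (Fin 3) K)))
  haveI hUCK := isUltrametricDist_submodule (LinearMap.ker ((LinearMap.mulLeft K (Matrix.single (2 : Fin 3) (0 : Fin 3) (1 : K)) - LinearMap.mulRight K (Matrix.single (2 : Fin 3) (0 : Fin 3) (1 : K))) : Module.End K (Matrix (Fin 3) (Fin 3) K)))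
  haveI : IsUltrametricDist (↥(LinearMap.range ((LinearMap.mulLeft K (Matrix.single (2 : Fin 3) (0 : Fin 3) (1 : K)) - LinearMap.mulRight K (Matrix.single (2 : Fin 3) (0 : Fin 3) (1 : K))) : Module.End K (Matrix (Fin 3) (Fin 3) K))) × ↥(LinearMap.ker ((LinearMap.mulLeft K (Matrix.single (2 : Fin 3) (0 : Fin 3) (1 : K)) - LinearMap.mulRight K (Matrix.single (2 : Fin 3) (0 : Fin 3) (1 : K))) : Module.End K (Matrix (Fin 3) (Fin 3) K)))) := isUltrametricDist_prod
  haveI : IsUltrametricDist ↥Q := ⟨fun a b d => IsUltrametricDist.dist_triangle_max (a : Matrix (Fin 3) (Fin 3) K) b d⟩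
  haveI : IsUltrametricDist ↥C := ⟨fun a b d => IsUltrametricDist.dist_triangle_max (a : Matrix (Fin 3) (Fin 3) K) b d⟩
  haveI : IsUltrametricDist (↥Q × ↥C) := isUltrametricDist_prod
  have h𝔲₀cl : IsClosed (𝔲₀ : Set (Matrix (Fin 3) (Fin 3) K)) := by
    have : (𝔲₀ : Set (Matrix (Fin 3) (Fin 3) K)) =
        {X : Matrix (Fin 3) (Fin 3) K | (X.map σ)ᵀ * !![(0 : K), 0, 1; 0, 1, 0; 1, 0, 0] + !![(0 : K), 0, 1; 0, 1, 0; 1, 0, 0] * X = 0} ∩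
          {X | Matrix.trace X = 0} := Set.ext fun X => by simpa using h𝔲₀ X
    rw [this]
    exact (isClosed_skew σ _ hσc).inter (isClosed_eq (continuous_id.matrix_trace) continuous_const)
  have hentry : ∀ i j : Fin 3, Continuous fun X : Matrix (Fin 3) (Fin 3) K => X i j := fun i j => continuous_id.matrix_elem i j
  have hQcl : IsClosed (Q : Set (Matrix (Fin 3) (Fin 3) K)) := by
    have : (Q : Set (Matrix (Fin 3) (Fin 3) K)) = (𝔲₀ : Set (Matrix (Fin 3) (Fin 3) K)) ∩
        ({Y | Y 0 1 = 0} ∩ {Y | Y 0 2 = 0} ∩ {Y | Y 1 1 = 0} ∩ {Y | Y 1 2 = 0} ∩ {Y : Matrix (Fin 3) (Fin 3) K | Y 0 0 + Y 2 2 = 0}) := by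
      ext Y; simp only [SetLike.mem_coe, hQ, Set.mem_inter_iff, Set.mem_setOf_eq]; tauto
    rw [this]
    exact h𝔲₀cl.inter (((((isClosed_eq (hentry 0 1) continuous_const).inter (isClosed_eq (hentry 0 2) continuous_const)).inter
      (isClosed_eq (hentry 1 1) continuous_const)).inter (isClosed_eq (hentry 1 2) continuous_const)).inter
      (isClosed_eq ((hentry 0 0).add (hentry 2 2)) continuous_const))
  have hCcl : IsClosed (C : Set (Matrix (Fin 3) (Fin 3) K)) := by
    have : (C : Set (Matrix (Fin 3) (Fin 3) K)) = (𝔲₀ : Set (Matrix (Fin 3) (Fin 3) K)) ∩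
        {Z : Matrix (Fin 3) (Fin 3) K | Z * Matrix.single (2 : Fin 3) (0 : Fin 3) (1 : K) = Matrix.single (2 : Fin 3) (0 : Fin 3) 1 * Z} := by
      ext Z; simp only [SetLike.mem_coe, hC, Set.mem_inter_iff, Set.mem_setOf_eq]
    rw [this]
    exact h𝔲₀cl.inter (isClosed_eq (continuous_id.matrix_mul continuous_const) (continuous_const.matrix_mul continuous_id))
  haveI : ProperSpace ↥𝔲₀ := properSpace_subtype_of_isClosed h𝔲₀cl
  haveI : ProperSpace ↥Q := properSpace_subtype_of_isClosed hQcl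
  haveI : ProperSpace ↥C := properSpace_subtype_of_isClosed hCcl
  haveI : SecondCountableTopology ↥𝔲₀ := TopologicalSpace.Subtype.secondCountableTopology _
  haveI : SecondCountableTopology ↥Q := TopologicalSpace.Subtype.secondCountableTopology _
  haveI : SecondCountableTopology ↥C := TopologicalSpace.Subtype.secondCountableTopology _
  haveI hB : BorelSpace (↥Q × ↥C) := Prod.borelSpace
  haveI : LocallyCompactSpace (Matrix (Fin 3) (Fin 3) K) := inferInstanceAs (LocallyCompactSpace (Fin 3 → Fin 3 → K))
  haveI : LocallyCompactSpace ↥Q := hQcl.isClosedEmbedding_subtypeVal.locallyCompactSpace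
  haveI : LocallyCompactSpace ↥C := hCcl.isClosedEmbedding_subtypeVal.locallyCompactSpace
  haveI : LocallyCompactSpace ↥𝔲₀ := h𝔲₀cl.isClosedEmbedding_subtypeVal.locallyCompactSpace
  haveI : SigmaCompactSpace ↥Q := sigmaCompactSpace_of_locallyCompact_secondCountable
  haveI : SigmaCompactSpace ↥C := sigmaCompactSpace_of_locallyCompact_secondCountable
  haveI : SigmaCompactSpace ↥𝔲₀ := sigmaCompactSpace_of_locallyCompact_secondCountable
  haveI hHaar : (μQ.prod μC).IsAddHaarMeasure := Measure.prod.instIsAddHaarMeasure μQ μC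
  haveI hFin : IsFiniteMeasureOnCompacts (μQ.prod μC) := hHaar.toIsFiniteMeasureOnCompacts
  haveI hLinv : (μQ.prod μC).IsAddLeftInvariant := hHaar.toIsAddLeftInvariant
  have hQK : ∀ Y : ↥Q, (Y : Matrix (Fin 3) (Fin 3) K) ∈ (LinearMap.range ((LinearMap.mulLeft K (Matrix.single (2 : Fin 3) (0 : Fin 3) (1 : K)) - LinearMap.mulRight K (Matrix.single (2 : Fin 3) (0 : Fin 3) (1 : K))) : Module.End K (Matrix (Fin 3) (Fin 3) K))) := fun Y => by
    obtain ⟨-, hsh⟩ := (hQ _).1 Y.2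
    obtain ⟨A, hA⟩ := exists_bracket_single_two_zero_eq_of_shape hsh
    exact ⟨A, by rw [adK_apply]; exact hA⟩
  have hCK : ∀ Z : ↥C, (Z : Matrix (Fin 3) (Fin 3) K) ∈ (LinearMap.ker ((LinearMap.mulLeft K (Matrix.single (2 : Fin 3) (0 : Fin 3) (1 : K)) - LinearMap.mulRight K (Matrix.single (2 : Fin 3) (0 : Fin 3) (1 : K))) : Module.End K (Matrix (Fin 3) (Fin 3) K))) := fun Z => by
    obtain ⟨-, hcomm⟩ := (hC _).1 Z.2
    rw [LinearMap.mem_ker, adK_apply, sub_eq_zero]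
    exact hcomm.symm
  obtain ⟨ι, hιdef⟩ : ∃ ι : (↥Q × ↥C) → (↥(LinearMap.range ((LinearMap.mulLeft K (Matrix.single (2 : Fin 3) (0 : Fin 3) (1 : K)) - LinearMap.mulRight K (Matrix.single (2 : Fin 3) (0 : Fin 3) (1 : K))) : Module.End K (Matrix (Fin 3) (Fin 3) K))) × ↥(LinearMap.ker ((LinearMap.mulLeft K (Matrix.single (2 : Fin 3) (0 : Fin 3) (1 : K)) - LinearMap.mulRight K (Matrix.single (2 : Fin 3) (0 : Fin 3) (1 : K))) : Module.End K (Matrix (Fin 3) (Fin 3) K)))), ι = fun q => (⟨(q.1 : Matrix (Fin 3) (Fin 3) K), hQK q.1⟩, ⟨(q.2 : Matrix (Fin 3) (Fin 3) K), hCK q.2⟩) := ⟨_, rfl⟩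
  have hι1 : ∀ q, ((ι q).1 : Matrix (Fin 3) (Fin 3) K) = (q.1 : Matrix (Fin 3) (Fin 3) K) := fun q => by rw [hιdef]
  have hι2 : ∀ q, ((ι q).2 : Matrix (Fin 3) (Fin 3) K) = (q.2 : Matrix (Fin 3) (Fin 3) K) := fun q => by rw [hιdef]
  have hιnorm : ∀ q, ‖ι q‖ = ‖q‖ := fun q => by subst hιdef; rfl
  have hιe : ∀ q, eK (ι q) = ((e q : ↥𝔲₀) : Matrix (Fin 3) (Fin 3) K) := fun q => by rw [heK, he, hι1, hι2]
  have hιsymm : ∀ X : ↥𝔲₀, ι (e.symm X) = eK.symm (X : Matrix (Fin 3) (Fin 3) K) := fun X => by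
    apply eK.injective
    rw [hιe, AddEquiv.apply_symm_apply, ContinuousLinearEquiv.apply_symm_apply]
  have hιcont : Continuous ι := by
    rw [hιdef]
    exact ((continuous_subtype_val.comp continuous_fst).subtype_mk _).prodMk ((continuous_subtype_val.comp continuous_snd).subtype_mk _)
  have hcont : Continuous e := by
    have h1 : Continuous fun q : ↥Q × ↥C => ((e q : ↥𝔲₀) : Matrix (Fin 3) (Fin 3) K) := by
      have : (fun q : ↥Q × ↥C => ((e q : ↥𝔲₀) : Matrix (Fin 3) (Fin 3) K)) = fun q => eK (ι q) := funext fun q => (hιe q).symm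
      rw [this]
      exact eK.continuous.comp hιcont
    exact h1.subtype_mk _
  have hcont' : Continuous e.symm := by
    have h1 : Continuous fun X : ↥𝔲₀ => ((((e.symm X).1 : ↥Q) : Matrix (Fin 3) (Fin 3) K), (((e.symm X).2 : ↥C) : Matrix (Fin 3) (Fin 3) K)) := by
      have : (fun X : ↥𝔲₀ => ((((e.symm X).1 : ↥Q) : Matrix (Fin 3) (Fin 3) K), (((e.symm X).2 : ↥C) : Matrix (Fin 3) (Fin 3) K))) =
          fun X : ↥𝔲₀ => ((((eK.symm (X : Matrix (Fin 3) (Fin 3) K)).1) : Matrix (Fin 3) (Fin 3) K), (((eK.symm (X : Matrix (Fin 3) (Fin 3) K)).2) : Matrix (Fin 3) (Fin 3) K)) := by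
        funext X
        rw [← hι1, ← hι2, hιsymm]
      rw [this]
      exact ((continuous_subtype_val.comp continuous_fst).prodMk (continuous_subtype_val.comp continuous_snd)).comp
        (eK.symm.continuous.comp continuous_subtype_val)
    exact ((continuous_fst.comp h1).subtype_mk _).prodMk ((continuous_snd.comp h1).subtype_mk _)
  obtain ⟨e', he'⟩ : ∃ e' : (↥Q × ↥C) ≃ₜ+ ↥𝔲₀, ∀ q, e' q = e q :=
    ⟨{ e with continuous_toFun := hcont, continuous_invFun := hcont' }, fun q => rfl⟩
  have h2σ : σ c + c = 0 := by rw [hc]; ring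
  have hNskew := (UnitaryThreeWitt.single_zero_two_mem_iff σ c).2 h2σ
  have hNtr : Matrix.trace (Matrix.single (0 : Fin 3) (2 : Fin 3) c) = 0 := Matrix.trace_single_eq_of_ne (0 : Fin 3) (2 : Fin 3) c (by decide)
  have hJdet : IsUnit (!![(0 : K), 0, 1; 0, 1, 0; 1, 0, 0] : Matrix (Fin 3) (Fin 3) K).det := by
    rw [UnitaryThreeWitt.det_antidiagonal_three]; exact isUnit_one.neg
  have hmem : ∀ q : ↥Q × ↥C,
      cayley (q.1 : Matrix (Fin 3) (Fin 3) K) * (Matrix.single (0 : Fin 3) (2 : Fin 3) c + (q.2 : Matrix (Fin 3) (Fin 3) K)) *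
          Ring.inverse (cayley (q.1 : Matrix (Fin 3) (Fin 3) K)) - Matrix.single (0 : Fin 3) (2 : Fin 3) c ∈ 𝔲₀ := fun q => by
    obtain ⟨hY𝔲, -⟩ := (hQ _).1 q.1.2
    obtain ⟨hZ𝔲, -⟩ := (hC _).1 q.2.2
    obtain ⟨hYs, -⟩ := (h𝔲₀ _).1 hY𝔲
    obtain ⟨hZs, hZt⟩ := (h𝔲₀ _).1 hZ𝔲
    exact (h𝔲₀ _).2 ⟨slice_sub_mem σ _ hJdet hNskew hYs hZs, trace_slice_sub_eq_zero hNtr hZt⟩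
  obtain ⟨φ, hφdef⟩ : ∃ φ : (↥Q × ↥C) → ↥𝔲₀,
      φ = fun q => ⟨cayley (q.1 : Matrix (Fin 3) (Fin 3) K) * (Matrix.single (0 : Fin 3) (2 : Fin 3) c + (q.2 : Matrix (Fin 3) (Fin 3) K)) *
          Ring.inverse (cayley (q.1 : Matrix (Fin 3) (Fin 3) K)) - Matrix.single (0 : Fin 3) (2 : Fin 3) c, hmem q⟩ := ⟨_, rfl⟩
  have hφval : ∀ q, ((φ q : ↥𝔲₀) : Matrix (Fin 3) (Fin 3) K) =
      cayley (q.1 : Matrix (Fin 3) (Fin 3) K) * (Matrix.single (0 : Fin 3) (2 : Fin 3) c + (q.2 : Matrix (Fin 3) (Fin 3) K)) *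
          Ring.inverse (cayley (q.1 : Matrix (Fin 3) (Fin 3) K)) - Matrix.single (0 : Fin 3) (2 : Fin 3) c := fun q => by rw [hφdef]
  have hφ0Z : ∀ Z : ↥C, φ ((0 : ↥Q), Z) = e' ((0 : ↥Q), Z) := fun Z => by
    apply Subtype.ext
    rw [hφval, he', he]
    simp [cayley_zero]
  have hφ0 : φ 0 = 0 := by
    have h := hφ0Z 0
    rw [show ((0 : ↥Q), (0 : ↥C)) = (0 : ↥Q × ↥C) from rfl, map_zero] at h
    exact h
  have hNP : ∀ k, k₀ ≤ k → ∀ j, k ≤ j → ∀ x ∈ closedBall (0 : ↥Q × ↥C) (r * γ ^ k), ∀ y ∈ closedBall (0 : ↥Q × ↥C) (r * γ ^ j),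
      φ (0 + (x + y)) - φ (0 + x) - e' y ∈ (e' : _ → ↥𝔲₀) '' closedBall 0 (r * γ ^ (j + 1)) := by
    intro k hk j hj x hx y hy
    have hx' : ι x ∈ closedBall (0 : (↥(LinearMap.range ((LinearMap.mulLeft K (Matrix.single (2 : Fin 3) (0 : Fin 3) (1 : K)) - LinearMap.mulRight K (Matrix.single (2 : Fin 3) (0 : Fin 3) (1 : K))) : Module.End K (Matrix (Fin 3) (Fin 3) K))) × ↥(LinearMap.ker ((LinearMap.mulLeft K (Matrix.single (2 : Fin 3) (0 : Fin 3) (1 : K)) - LinearMap.mulRight K (Matrix.single (2 : Fin 3) (0 : Fin 3) (1 : K))) : Module.End K (Matrix (Fin 3) (Fin 3) K))))) (r * γ ^ k) := by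
      rw [mem_closedBall_zero_iff] at hx ⊢; rwa [hιnorm]
    have hy' : ι y ∈ closedBall (0 : (↥(LinearMap.range ((LinearMap.mulLeft K (Matrix.single (2 : Fin 3) (0 : Fin 3) (1 : K)) - LinearMap.mulRight K (Matrix.single (2 : Fin 3) (0 : Fin 3) (1 : K))) : Module.End K (Matrix (Fin 3) (Fin 3) K))) × ↥(LinearMap.ker ((LinearMap.mulLeft K (Matrix.single (2 : Fin 3) (0 : Fin 3) (1 : K)) - LinearMap.mulRight K (Matrix.single (2 : Fin 3) (0 : Fin 3) (1 : K))) : Module.End K (Matrix (Fin 3) (Fin 3) K))))) (r * γ ^ j) := by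
      rw [mem_closedBall_zero_iff] at hy ⊢; rwa [hιnorm]
    obtain ⟨z, hz, hzeq⟩ := hNK k hk j hj (ι x) hx' (ι y) hy'
    have hval : eK z = ((φ (0 + (x + y)) - φ (0 + x) - e' y : ↥𝔲₀) : Matrix (Fin 3) (Fin 3) K) := by
      rw [hzeq]
      simp only [zero_add, AddSubgroupClass.coe_sub, hφval, he', ← hιe, hι1, hι2, Prod.fst_add, Prod.snd_add, Submodule.coe_add, AddSubgroup.coe_add]
      abel
    have hzu : eK z ∈ 𝔲₀ := by rw [hval]; exact Subtype.mem _
    refine ⟨e.symm ⟨eK z, hzu⟩, ?_, ?_⟩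
    · rw [mem_closedBall_zero_iff] at hz ⊢
      rw [← hιnorm, hιsymm, ContinuousLinearEquiv.symm_apply_apply]
      exact hz
    · apply Subtype.ext
      rw [he', AddEquiv.apply_symm_apply]
      exact hval
  obtain ⟨Λ, hΛ⟩ := exists_addSubgroup_coe_eq_closedBall (↥Q × ↥C) hr hγ0
  have hchart := @depth_chart_of_newtonData _ _ _ _ _ hB _ _ _ ‹BorelSpace ↥𝔲₀› (μQ.prod μC) hFin hLinv φ 0 e' Λ r γ hΛ hr hγ0 hγ1 k₀ hNP
  set μ : Measure (↥Q × ↥C) := μQ.prod μC with hμdef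
  have hanti : Antitone Λ := antitone_of_coe_eq_closedBall hΛ hr.le hγ0.le hγ1.le
  have hopen : ∀ j, IsOpen (Λ j : Set (↥Q × ↥C)) := isOpen_of_coe_eq_closedBall hΛ hr hγ0
  have hcomp : ∀ j, IsCompact (Λ j : Set (↥Q × ↥C)) := isCompact_of_coe_eq_closedBall hΛ
  have hbasis : ∀ U ∈ 𝓝 (0 : ↥Q × ↥C), ∃ j, (Λ j : Set (↥Q × ↥C)) ⊆ U := exists_subset_of_mem_nhds_of_coe_eq_closedBall hΛ hr hγ1
  obtain ⟨hinj, himg, -, hlin⟩ := hchart k₀ le_rfl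
  rw [zero_vadd] at hinj
  have he'Z : ∀ Z : ↥C, ((e' ((0 : ↥Q), Z) : ↥𝔲₀) : Matrix (Fin 3) (Fin 3) K) = (Z : Matrix (Fin 3) (Fin 3) K) := fun Z => by
    rw [he', he]
    simp only [ZeroMemClass.coe_zero, mul_zero, zero_mul, sub_self, smul_zero, zero_add]
  have key : ∀ Z₀ : ↥C, ((0 : ↥Q), Z₀) ∈ Λ k₀ → ∀ j, k₀ ≤ j → ∀ h : ↥𝔲₀ → ℝ≥0∞, Measurable h →
      ∫⁻ v in ((0 : ↥Q), Z₀) +ᵥ (Λ j : Set (↥Q × ↥C)), h (φ v) ∂μ = ∫⁻ v in ((0 : ↥Q), Z₀) +ᵥ (Λ j : Set (↥Q × ↥C)), h (e' v) ∂μ := by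
    intro Z₀ hZ₀ j hj h hm
    set S : Set (↥Q × ↥C) := ((0 : ↥Q), Z₀) +ᵥ (Λ j : Set (↥Q × ↥C)) with hSdef
    have hSsub : S ⊆ (Λ k₀ : Set (↥Q × ↥C)) := by
      rintro x ⟨y, hy, rfl⟩
      exact (Λ k₀).add_mem hZ₀ (hanti hj hy)
    have hScomp : IsCompact S := (hcomp j).image (continuous_const.add continuous_id)
    have hSm : MeasurableSet S := hScomp.isClosed.measurableSet
    have hφS : φ '' S = e' '' S := by
      have h1 := himg j hj ((0 : ↥Q), Z₀) hZ₀
      rw [zero_add, hφ0Z] at h1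
      rw [hSdef]
      exact h1.trans (image_vadd_eq e' ((0 : ↥Q), Z₀) (Λ j : Set (↥Q × ↥C))).symm
    have heSm : MeasurableSet (⇑e' '' S) := (hScomp.image e'.continuous).isClosed.measurableSet
    have hΛm : MeasurableSet (Λ k₀ : Set (↥Q × ↥C)) := (hopen k₀).measurableSet
    have h1 := hlin ((⇑e' '' S).indicator h) (hm.indicator heSm)
    simp only [zero_add, hφ0] at h1
    have hL : ∫⁻ v in (Λ k₀ : Set (↥Q × ↥C)), (⇑e' '' S).indicator h (φ v) ∂μ = ∫⁻ v in S, h (φ v) ∂μ := by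
      have hpt : EqOn (fun v => (⇑e' '' S).indicator h (φ v)) (S.indicator fun v => h (φ v)) (Λ k₀ : Set (↥Q × ↥C)) := by
        intro v hv
        show (⇑e' '' S).indicator h (φ v) = S.indicator (fun v => h (φ v)) v
        by_cases hvS : v ∈ S
        · rw [indicator_of_mem hvS, indicator_of_mem]
          rw [← hφS]; exact mem_image_of_mem φ hvS
        · rw [indicator_of_notMem hvS, indicator_of_notMem]
          intro hφv
          rw [← hφS] at hφv
          obtain ⟨w, hw, hwv⟩ := hφv
          exact hvS (hinj (hSsub hw) hv hwv ▸ hw)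
      rw [setLIntegral_congr_fun hΛm hpt, lintegral_indicator hSm, Measure.restrict_restrict hSm, inter_eq_left.2 hSsub]
    have hpt : ∀ v, (⇑e' '' S).indicator h (e' v) = S.indicator (fun v => h (e' v)) v := fun v => by
      rw [← indicator_comp_right, e'.injective.preimage_image]; rfl
    have hR : ∫⁻ v in (Λ k₀ : Set (↥Q × ↥C)), (⇑e' '' S).indicator h (e' v) ∂μ = ∫⁻ v in S, h (e' v) ∂μ := by
      rw [setLIntegral_congr_fun hΛm (fun v _ => hpt v), lintegral_indicator hSm, Measure.restrict_restrict hSm, inter_eq_left.2 hSsub]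
    exact hL.symm.trans (h1.trans hR)
  set W : Set ↥C := (fun Z : ↥C => ((0 : ↥Q), Z)) ⁻¹' (Λ k₀ : Set (↥Q × ↥C)) with hWdef
  have hW : W ∈ 𝓝 (0 : ↥C) := by
    refine (continuous_const.prodMk continuous_id).continuousAt.preimage_mem_nhds ?_
    exact (hopen k₀).mem_nhds (show ((0 : ↥Q), (0 : ↥C)) ∈ (Λ k₀ : Set (↥Q × ↥C)) from (Λ k₀).zero_mem)
  set h' : ↥𝔲₀ → ℝ≥0∞ := fun X => g (Matrix.single (0 : Fin 3) (2 : Fin 3) c + (X : Matrix (Fin 3) (Fin 3) K)) with hh'def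
  have hh'm : Measurable h' := (hgc.comp (continuous_const.add continuous_subtype_val)).measurable
  set F : ↥C → ℝ≥0∞ := fun Z => g (Matrix.single (0 : Fin 3) (2 : Fin 3) c + (Z : Matrix (Fin 3) (Fin 3) K)) with hFdef
  have hFm : Measurable F := (hgc.comp (continuous_const.add continuous_subtype_val)).measurable
  have hbox : ∀ v : ↥Q × ↥C, v ∈ (Λ k₀ : Set (↥Q × ↥C)) → h' (φ v) = F v.2 := by
    intro v hv
    have hn : ‖((v.1 : ↥Q) : Matrix (Fin 3) (Fin 3) K)‖ < 1 := by
      have h1 : ‖v‖ ≤ r * γ ^ k₀ := (mem_iff_norm_le_of_coe_eq_closedBall hΛ).1 hv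
      have h2 : r * γ ^ k₀ < 1 := by
        calc r * γ ^ k₀ ≤ r * 1 := by gcongr; exact pow_le_one₀ hγ0.le hγ1.le
          _ < 1 := by rw [mul_one]; exact hr1
      calc ‖((v.1 : ↥Q) : Matrix (Fin 3) (Fin 3) K)‖ = ‖v.1‖ := rfl
        _ ≤ ‖v‖ := norm_fst_le v
        _ < 1 := h1.trans_lt h2
    simp only [hh'def, hFdef, hφval, add_sub_cancel]
    exact hg _ _ (charpoly_slice_eq hn)
  have htonelli : ∀ (Z₀ : ↥C) (ρ : ℝ), ∫⁻ v in closedBall (0 : ↥Q) ρ ×ˢ closedBall Z₀ ρ, F v.2 ∂μ = μQ (closedBall (0 : ↥Q) ρ) * ∫⁻ Z in closedBall Z₀ ρ, F Z ∂μC := by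
    intro Z₀ ρ
    rw [hμdef, ← Measure.prod_restrict, lintegral_prod (fun v : ↥Q × ↥C => F v.2) (hFm.comp measurable_snd).aemeasurable]
    simp only [lintegral_const, Measure.restrict_apply_univ]
    rw [mul_comm]
  have hSprod : ∀ (Z₀ : ↥C) (j : ℕ), ((0 : ↥Q), Z₀) +ᵥ (Λ j : Set (↥Q × ↥C)) = closedBall (0 : ↥Q) (r * γ ^ j) ×ˢ closedBall Z₀ (r * γ ^ j) := by
    intro Z₀ j
    rw [hΛ, closedBall_prod_same]
    ext x
    rw [Set.mem_vadd_set]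
    constructor
    · rintro ⟨y, hy, rfl⟩
      rw [mem_closedBall, vadd_eq_add, dist_eq_norm, add_sub_cancel_left]
      rwa [mem_closedBall_zero_iff] at hy
    · intro hx
      refine ⟨x - ((0 : ↥Q), Z₀), ?_, by rw [vadd_eq_add, add_sub_cancel]⟩
      rw [mem_closedBall_zero_iff, ← dist_eq_norm]; exact hx
  have hident : ∀ Z₀ : ↥C, ((0 : ↥Q), Z₀) ∈ Λ k₀ → ∀ j, k₀ ≤ j →
      μQ (closedBall (0 : ↥Q) (r * γ ^ j)) * ∫⁻ Z in closedBall Z₀ (r * γ ^ j), F Z ∂μC =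
        ∫⁻ v in ((0 : ↥Q), Z₀) +ᵥ (Λ j : Set (↥Q × ↥C)), h' (e' v) ∂μ := by
    intro Z₀ hZ₀ j hj
    have hSsub : ((0 : ↥Q), Z₀) +ᵥ (Λ j : Set (↥Q × ↥C)) ⊆ (Λ k₀ : Set (↥Q × ↥C)) := by
      rintro x ⟨y, hy, rfl⟩; exact (Λ k₀).add_mem hZ₀ (hanti hj hy)
    have hSm : MeasurableSet (((0 : ↥Q), Z₀) +ᵥ (Λ j : Set (↥Q × ↥C))) :=
      ((hcomp j).image (continuous_const.add continuous_id)).isClosed.measurableSet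
    rw [← key Z₀ hZ₀ j hj h' hh'm, setLIntegral_congr_fun hSm (fun v hv => hbox v (hSsub hv)), hSprod, htonelli]
  refine ⟨W, hW, ?_, ?_⟩
  · -- DOWN
    intro Z₀ hZ₀ X₀ hX₀ hfin
    have hZ₀' : ((0 : ↥Q), Z₀) ∈ Λ k₀ := hZ₀
    obtain ⟨hZ𝔲, -⟩ := (hC _).1 Z₀.2
    set Zhat : ↥𝔲₀ := ⟨(Z₀ : Matrix (Fin 3) (Fin 3) K), hZ𝔲⟩ with hZhat
    have hrec : ∃ U ∈ 𝓝 Zhat, ∫⁻ X in U, h' X ∂μ₀ < ∞ := by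
      obtain ⟨U₁, hU₁, hU₁f⟩ := (exists_nhds_setLIntegral_lt_top_iff_zero μ₀ X₀ (fun X : ↥𝔲₀ => g (X : Matrix (Fin 3) (Fin 3) K))).1 hfin
      refine (exists_nhds_setLIntegral_lt_top_iff_zero μ₀ Zhat h').2 ⟨U₁, hU₁, ?_⟩
      have : ∀ x : ↥𝔲₀, h' (Zhat + x) = g (((X₀ + x : ↥𝔲₀)) : Matrix (Fin 3) (Fin 3) K) := fun x => by
        simp only [hh'def, hZhat, AddSubgroup.coe_add, hX₀]; rw [add_assoc]
      simp_rw [this]; exact hU₁f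
    obtain ⟨U', hU', hU'f⟩ := hrec
    have he'Z₀ : e' ((0 : ↥Q), Z₀) = Zhat := Subtype.ext (by rw [he'Z])
    have hpre : (fun X : ↥𝔲₀ => Zhat + X) ⁻¹' U' ∈ 𝓝 (0 : ↥𝔲₀) :=
      (continuous_const.add continuous_id).continuousAt.preimage_mem_nhds (by simpa using hU')
    have hpre' : ⇑e' ⁻¹' ((fun X : ↥𝔲₀ => Zhat + X) ⁻¹' U') ∈ 𝓝 (0 : ↥Q × ↥C) :=
      e'.continuous.continuousAt.preimage_mem_nhds (by simpa using hpre)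
    obtain ⟨j, hj⟩ := hbasis _ hpre'
    set j' := max j k₀ with hj'def
    have hj'k : k₀ ≤ j' := le_max_right _ _
    have hsubU : ⇑e' '' (((0 : ↥Q), Z₀) +ᵥ (Λ j' : Set (↥Q × ↥C))) ⊆ U' := by
      rw [image_vadd_eq, he'Z₀]
      rintro X ⟨Y, ⟨y, hy, rfl⟩, rfl⟩
      have hy' : y ∈ (Λ j : Set (↥Q × ↥C)) := hanti (le_max_left j k₀) hy
      exact hj hy'
    have hfinS : ∫⁻ X in ⇑e' '' (((0 : ↥Q), Z₀) +ᵥ (Λ j' : Set (↥Q × ↥C))), h' X ∂μ₀ < ∞ :=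
      (lintegral_mono_set hsubU).trans_lt hU'f
    have hfinS' := (setLIntegral_image_lt_top_iff e' μ μ₀ h' _).1 hfinS
    rw [← hident Z₀ hZ₀' j' hj'k] at hfinS'
    have hρ : 0 < r * γ ^ j' := mul_pos hr (pow_pos hγ0 _)
    have hQpos : μQ (closedBall (0 : ↥Q) (r * γ ^ j')) ≠ 0 := by
      intro h0
      have hΛ0 : μ (Λ j' : Set (↥Q × ↥C)) = 0 := by
        rw [hΛ, show (0 : ↥Q × ↥C) = ((0 : ↥Q), (0 : ↥C)) from rfl, ← closedBall_prod_same, hμdef, Measure.prod_prod, h0, zero_mul]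
      exact (hopen j').measure_ne_zero μ ⟨0, (Λ j').zero_mem⟩ hΛ0
    refine ⟨closedBall Z₀ (r * γ ^ j'), closedBall_mem_nhds Z₀ hρ, ?_⟩
    rcases ENNReal.mul_lt_top_iff.1 hfinS' with ⟨-, h⟩ | h | h
    · exact h
    · exact absurd h hQpos
    · rw [h]; exact ENNReal.zero_lt_top
  · -- UP
    rintro ⟨U', hU', hU'f⟩ X₀ hX₀
    obtain ⟨ε, hε, hεU⟩ := Metric.mem_nhds_iff.1 hU'
    obtain ⟨j, hj⟩ := exists_pow_lt_of_lt_one (div_pos hε hr) hγ1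
    set j' := max j k₀ with hj'def
    have hj'k : k₀ ≤ j' := le_max_right _ _
    have hρε : r * γ ^ j' < ε := by
      have h1 : γ ^ j' ≤ γ ^ j := pow_le_pow_of_le_one hγ0.le hγ1.le (le_max_left _ _)
      calc r * γ ^ j' ≤ r * γ ^ j := by gcongr
        _ < r * (ε / r) := by gcongr
        _ = ε := mul_div_cancel₀ ε hr.ne'
    have hsub : closedBall (0 : ↥C) (r * γ ^ j') ⊆ U' := (closedBall_subset_ball hρε).trans hεU
    have hfinC : ∫⁻ Z in closedBall (0 : ↥C) (r * γ ^ j'), F Z ∂μC < ∞ := (lintegral_mono_set hsub).trans_lt hU'f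
    have hQfin : μQ (closedBall (0 : ↥Q) (r * γ ^ j')) < ∞ := by
      have hc : IsCompact (Prod.fst '' (Λ j' : Set (↥Q × ↥C))) := (hcomp j').image continuous_fst
      rw [hΛ, show (0 : ↥Q × ↥C) = ((0 : ↥Q), (0 : ↥C)) from rfl, ← closedBall_prod_same,
        fst_image_prod _ ⟨(0 : ↥C), mem_closedBall_self (mul_pos hr (pow_pos hγ0 _)).le⟩] at hc
      exact hc.measure_lt_top
    have h0mem : ((0 : ↥Q), (0 : ↥C)) ∈ Λ k₀ := (Λ k₀).zero_mem
    have hfinS' : ∫⁻ v in ((0 : ↥Q), (0 : ↥C)) +ᵥ (Λ j' : Set (↥Q × ↥C)), h' (e' v) ∂μ < ∞ := by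
      rw [← hident 0 h0mem j' hj'k]
      exact ENNReal.mul_lt_top hQfin hfinC
    have hfinS := (setLIntegral_image_lt_top_iff e' μ μ₀ h' _).2 hfinS'
    have hnhds : ⇑e' '' (((0 : ↥Q), (0 : ↥C)) +ᵥ (Λ j' : Set (↥Q × ↥C))) ∈ 𝓝 (0 : ↥𝔲₀) := by
      rw [show ((0 : ↥Q), (0 : ↥C)) = (0 : ↥Q × ↥C) from rfl, zero_vadd]
      have h := e'.toHomeomorph.isOpenMap.image_mem_nhds ((hopen j').mem_nhds (Λ j').zero_mem)
      have h0 : e'.toHomeomorph 0 = (0 : ↥𝔲₀) := map_zero e'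
      rw [h0] at h
      exact h
    refine (exists_nhds_setLIntegral_lt_top_iff_zero μ₀ X₀ (fun X : ↥𝔲₀ => g (X : Matrix (Fin 3) (Fin 3) K))).2 ⟨_, hnhds, ?_⟩
    have : ∀ x : ↥𝔲₀, g (((X₀ + x : ↥𝔲₀)) : Matrix (Fin 3) (Fin 3) K) = h' x := fun x => by
      simp only [hh'def, AddSubgroup.coe_add, hX₀]
    simp_rw [this]; exact hfinS

end Chart


end Summit.HodgeConjecture.HodgeConjecture.Cruxes.H413.F0P3cStCharTSHCDSlodowySliceChart

end
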